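import Summits.HodgeConjecture.HodgeConjecture.Theses.TateCuspKLift
import Literature.AlgebraicGeometry.HodgeTheory.LefschetzOneOneHolds
import Literature.AlgebraicGeometry.HodgeTheory.TopDegreeClasses

/-!
# Line `fibre-numerical` for the crux `ArithmeticTateRestriction` (stmt-HodgeConjecture-9313),
# route `TateCuspKLift` — "a Tate fibre only sees NUMBERS; match them on the total space"

Strategist's ALTERNATIVE to the registered line `Lines/birth.lean` (graded piece → arithmetic
`KH₀`/`K₀`-gluing → weight detection).  Same crux, by name; a different seam.

THE LEVER.  On a ℚ̄-Tate (linear) projective fibre `X_o` the lowest-weight homology IS the Chow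
group: `CH_p(X_o) ⊗ ℚ ⥲ W_{-2p} H_{2p}(X_o; ℚ)` (Totaro 2014, Thm. 3; surjectivity Jannsen), and it
is finitely generated by closures of strata (Thm. 1).  Dually, a weight-`2p` class on `X_o` that is
pulled back from smooth projective varieties is DETERMINED BY FINITELY MANY RATIONAL NUMBERS — its
degrees on the `p`-dimensional subvarieties of the fibre (read on smooth projective `p`-folds
`h : Y → X_o`, where `H²ᵖ(Y(ℂ); ℂ)` is a line, tree theorem `finrank_complexBetti_two_mul_eq_one`).
So the crux "`ξ|X_o` is a pulled-back algebraic class" splits along a NUMERICAL seam: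

  STUB 1 `stub_fibreCycleDetection` (Deligne, Hodge III strictness + Totaro 2014, Thm. 3; known in
    print for linear fibres, no arithmetic, no `PB`) — on a ℚ̄-Tate projective fibre, a class pulled
    back from smooth projective varieties whose pull-back to EVERY smooth projective `p`-fold mapping
    to the fibre vanishes (i.e. all of whose degrees on `p`-cycles of the fibre vanish) is zero.
  STUB 2 `stub_numericalMatching` (THE HEART; HC-safe: `a := ξ` under HC, proved below) — the fibre
    cannot NUMERICALLY distinguish an absolute Hodge class `ξ` of the total space from the algebraic
    classes of the total space: there is `a ∈ algebraicClasses 𝒳 p` with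
    `deg (h ≫ ι)^* a = deg (h ≫ ι)^* ξ` for every smooth projective `p`-fold `h : Y → X_o`.
    Equivalently (finite-dimensional duality): every ℚ-combination of `p`-dimensional subvarieties
    of `X_o` that is numerically trivial against `Aᵖ(𝒳)` pairs to zero with `ξ` — homological =
    numerical equivalence ON THE SMOOTH TOTAL SPACE for `p`-cycles supported on the Tate fibre
    (a fragment of Grothendieck's standard conjecture D, implied by HC(𝒳), by D(𝒳), by B(𝒳) via
    Lieberman; unconditional for `p = 1`, for `N ≤ 3`/`p ∈ {0, 1, N-1, N}`, and for abelian-variety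
    total spaces up to the fibre-support restriction), and — after Totaro — a statement about the
    finite intersection matrix `⟨Hdgᵖ(𝒳), strata closures of X_o⟩`, computable case by case.

and the crux follows (`ArithmeticTateRestriction_of`, kernel-checked, no `sorry`): with `a` from
STUB 2, `u := ξ|X_o - a|X_o` is pulled back from the smooth projective `𝒳` and has all `p`-fold
degrees zero, so `u = 0` by STUB 1, i.e. `ξ|X_o = a|X_o ∈ PBᵖ(X_o)` (`Y := 𝒳`, `g := fiberι f o`).

WHY THIS DODGES THE BIRTH LINE'S HEART.  `birth.stub_absoluteHodgeKGluing` must produce an honest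
K-class ON THE SINGULAR FIBRE with prescribed pull-backs to test varieties of ALL dimensions: it
meets (i) `K₀` vs `KH₀` on Tate singularities (Barbieri-Viale–Srinivas), (ii) `F`-rationality of
every `Ext¹_MT(F)` step for Borel, (iii) the Milnor-flux species over `ℂ`.  Here NO object is built on
`X_o` at all: the output of the heart lives on the smooth projective total space (`a ∈ Nᵖ H²ᵖ(𝒳)`),
the conditions are finitely many intersection NUMBERS, and the tools are those of numerical versus
homological equivalence on smooth projective varieties (Lieberman 1968, Kleiman 1968/1994, André's
motivated cycles), plus polarisation linear algebra on `Hdgᵖ(𝒳) × Hdg^{N-p}(𝒳)`.  The absolute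
Hodge hypothesis is not consumed by the intended proof (it is kept in the signature because the crux
has it): the line bets that Tate fibres are numerically too poor to see the difference between Hodge
and algebraic classes — the exact opposite economy from `birth`, which bets on arithmetic rigidity.
Price: STUB 2 is not implied by the crux (it is implied by HC), so this line can die with the crux
alive; its death certificate would be a Tate degeneration whose strata detect a Hodge class of `𝒳`
numerically invisible to `Aᵖ(𝒳)` — a counterexample to D(𝒳) for fibre-supported cycles granted HC,
or to HC itself.

## Contents

* carriers VERBATIM from the crux / `Lines/birth.lean`: `pulledBackAlgebraicClasses`,
  `pulledBackClasses`, `IsQbarTate` (re-declared in this namespace; `Lines/*.lean` are not modules).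
* the two registered stubs (`sorry` ONLY there), the composition `ArithmeticTateRestriction_of`
  (stub₁ → stub₂ → crux BY NAME) and `ArithmeticTateRestriction_of_stubs`.
* PROVED: `numericalMatching_of_hodgeConjecture` (HC ⟹ STUB 2: HC-safety of the heart),
  `numericalMatching_of_mem_algebraicClasses` (the heart for an algebraic `ξ`, its one-line
  mechanism), and three unconditional rungs of the heart OUTSIDE the summit's open regime boundary
  cases: `numericalMatching_codimOne` (`p = 1`, Lefschetz (1,1)), `numericalMatching_dimLEThree`
  (`N ≤ 3`), `numericalMatching_degreeTop` (`p = N ≥ 1`, top-degree classes are algebraic).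
  First open instances of the heart: `p = 2 ≤ N - 2`, e.g. an absolute Hodge (Weil) class on an
  abelian or hyperkähler fourfold pencil degenerating to a ℚ̄-Tate fibre, against the `2`-dimensional
  strata closures of that fibre.

Disproof used: none on file (`ledger crux ls stmt-HodgeConjecture-9313`: `Lines/birth.*` only; no
`Disproof.lean`, no `_false_without_` theorem, no landed `Negative/` lemma; `ledger negatives
--problem HodgeConjecture`: 3 entries, none about this crux).
-/

set_option linter.dupNamespace false

noncomputable section

namespace Summit.HodgeConjecture.HodgeConjecture.Cruxes.ArithmeticTateRestriction.FibreNumerical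

open CategoryTheory
open Literature.AlgebraicGeometry.Motives Literature.AlgebraicGeometry.HodgeTheory
open Summit.HodgeConjecture.HodgeConjecture.Theses.TateCuspKLift (ArithmeticTateRestriction)

/-! ### The typable carriers (verbatim from the crux) -/

/-- `PB^p(X)`, the **pulled-back algebraic classes** of codimension `p` on a complex scheme `X`:
the `ℂ`-span of the pull-backs `g^*a` of algebraic classes `a ∈ algebraicClasses Y p` along
`ℂ`-morphisms `g : X ⟶ Y` to smooth projective varieties `Y` — the crux's inline conclusion,
verbatim. [cite: Arapura2016SingularLefschetz, §8 Lemma 8.6] [cite: Fulton1998, §15.2 (GRR)] -/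
def pulledBackAlgebraicClasses (X : SchemeOver ℂ) (p : ℕ) :
    Submodule ℂ (complexBetti X (2 * p)) :=
  Submodule.span ℂ {c : complexBetti X (2 * p) | ∃ (m : ℕ) (Y : SchemeOver ℂ)
    (_ : IsSmoothProjective m Y) (g : X ⟶ Y) (a : complexBetti Y (2 * p)),
    a ∈ algebraicClasses Y p ∧ c = (complexBetti.map g (2 * p)).hom a}

/-- `Tᵏ(X)`, the classes of `Hᵏ(X(ℂ); ℂ)` **pulled back from smooth projective varieties**: the
`ℂ`-span of all `g^*b`, `g : X ⟶ Y` a `ℂ`-morphism to a smooth projective `Y`, `b ∈ Hᵏ(Y(ℂ); ℂ)`.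
It contains the restrictions of ambient classes (`g = fiberι f o`, `Y = 𝒳`); Hodge-theoretically
it is a finite sum of images of PURE weight-`k` structures, hence meets `W_{k-1}Hᵏ(X) ⊗ ℂ` trivially
(strictness). [cite: DeligneHodgeIII1974, Thm. 8.2.4, Prop. 8.2.5] -/
def pulledBackClasses (X : SchemeOver ℂ) (k : ℕ) : Submodule ℂ (complexBetti X k) :=
  Submodule.span ℂ {c : complexBetti X k | ∃ (m : ℕ) (Y : SchemeOver ℂ)
    (_ : IsSmoothProjective m Y) (g : X ⟶ Y) (b : complexBetti Y k),
    c = (complexBetti.map g k).hom b}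

/-- `X/ℂ` is **ℚ̄-Tate** (the crux's hypothesis on the fibre, verbatim): `X` is isomorphic over `ℂ`
to the base change along some `σ : ℚ̄ →+* ℂ` of a ℚ̄-scheme `X₁` admitting a finite partition into
locally closed split tori (immersions with pairwise disjoint, jointly covering images).
[cite: Totaro2014ChowLinear, §1–§3 (linear schemes)] -/
def IsQbarTate (X : SchemeOver ℂ) : Prop :=
  ∃ (X₁ : SchemeOver (AlgebraicClosure ℚ)) (σ : AlgebraicClosure ℚ →+* ℂ)
    (_ : X ≅ (baseChangeHom σ).obj X₁) (ι : Type) (_ : Finite ι) (b : ι → ℕ)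
    (e : ∀ i : ι, specOver (AlgebraicClosure ℚ)
      (AddMonoidAlgebra (AlgebraicClosure ℚ) (Fin (b i) →₀ ℤ)) ⟶ X₁),
    (∀ i, AlgebraicGeometry.IsImmersion (e i).left) ∧
    (Pairwise fun i j => Disjoint (Set.range fun x => (e i).left.base x)
      (Set.range fun x => (e j).left.base x)) ∧
    (⋃ i, Set.range fun x => (e i).left.base x) = Set.univ

/-- The restriction `ξ|X_o = (fiberι f o)^* ξ` of an ambient class of the smooth projective total
space is a pulled-back class on the fibre (`g := fiberι f o`, `Y := 𝒳`). [folklore] -/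
theorem restrict_mem_pulledBackClasses {N k : ℕ} {𝒳 C : SchemeOver ℂ} (h𝒳 : IsSmoothProjective N 𝒳)
    (f : 𝒳 ⟶ C) (o : AlgPoints C ℂ) (ξ : complexBetti 𝒳 k) :
    (complexBetti.map (fiberι f o) k).hom ξ ∈ pulledBackClasses (fiberOver f o) k :=
  Submodule.subset_span ⟨N, 𝒳, h𝒳, fiberι f o, ξ, rfl⟩

/-- The restriction of an ambient ALGEBRAIC class lies in `PB^p(X_o)` (`Y := 𝒳`, `g := fiberι f o`)
— the last step of the composition and the mechanism of HC-safety. [folklore] -/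
theorem restrict_mem_pulledBackAlgebraicClasses {N p : ℕ} {𝒳 C : SchemeOver ℂ}
    (h𝒳 : IsSmoothProjective N 𝒳) (f : 𝒳 ⟶ C) (o : AlgPoints C ℂ) {a : complexBetti 𝒳 (2 * p)}
    (ha : a ∈ algebraicClasses 𝒳 p) :
    (complexBetti.map (fiberι f o) (2 * p)).hom a ∈ pulledBackAlgebraicClasses (fiberOver f o) p :=
  Submodule.subset_span ⟨N, 𝒳, h𝒳, fiberι f o, a, ha, rfl⟩

/-! ### The two registered stubs -/

/-- STUB 1 (known in print for linear fibres; L on this tree) — **fibre cycle detection: on a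
ℚ̄-Tate projective fibre, a class pulled back from smooth projective varieties that dies on every
smooth projective `p`-fold mapping to the fibre is zero.**  Proof in print: `T²ᵖ(X_o)` is a finite
sum of images of morphisms of mixed Hodge structures from PURE weight-`2p` structures, so by
strictness `T²ᵖ(X_o) ∩ W_{2p-1} = 0` (Deligne, Hodge III, Thm. 8.2.4 / 2.3.5), also after `⊗ ℂ`;
`W_{2p-1}H²ᵖ(X_o; ℚ)` is the annihilator of `W_{-2p}H_{2p}(X_o; ℚ)` (compact `X_o`: Borel–Moore =
ordinary homology; `H²ᵖ = Hom(H_{2p}, ℚ)` as mixed Hodge structures); for a LINEAR scheme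
`W_{-2p}H_{2p}(X_o; ℚ) = im (CH_p(X_o) ⊗ ℚ)` (Totaro 2014, Thm. 3; only the SURJECTIVITY, due to
Jannsen, is used — a ℚ̄-scheme with a finite stratification into split tori is linear, and linearity
is stable under base change to `ℂ`), spanned
by `cl(Z)`, `Z ⊆ X_o` irreducible of dimension `p`; and `⟨u, cl(Z)⟩ = ⟨h^*u, [Z̃]⟩` for a resolution
`h : Z̃ → Z ⊆ X_o` (Hironaka; `Z̃` smooth projective geometrically irreducible of dimension `p`, a
legitimate test), which vanishes iff `h^*u = 0` because `H²ᵖ(Z̃(ℂ); ℂ)` is a line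
(`finrank_complexBetti_two_mul_eq_one`).  Hence all `p`-fold pull-backs zero ⟹ `u ∈ W_{2p-1} ⊗ ℂ`
⟹ `u = 0`.  Compared with `birth.stub_weightDetection` it tests ONLY `p`-dimensional varieties
(numbers, not classes) and pays for it with the Tate hypothesis (Totaro); neither implies the other
cheaply.  Why it might fail: the crux's Tate clause is a bare finite partition into locally closed
tori with NO frontier condition ("closure of a stratum minus the stratum lies in lower-dimensional
strata", Totaro §2), while Thm. 3 is proved for linear schemes built by stratifications WITH it, and
finite torus partitions need not be filtrable at all (three planes `Z₁, Z₂, Z₃` meeting cyclically in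
points `a ∈ Z₁ ∩ Z₂`, `b ∈ Z₂ ∩ Z₃`, `c ∈ Z₃ ∩ Z₁`, with dense torus pieces `S₁ ∋ a`, `S₂ ∋ b`,
`S₃ ∋ c`: no piece of `S₁ ⊔ S₂ ⊔ S₃` is open or closed); an exotic non-filtrable torus partition of a
reducible fibre whose component closures have non-Tate resolutions could carry a non-Tate `Gr^W_{2p}`
with transcendental pulled-back classes orthogonal to all `p`-cycles (the same exposure as
`birth.stub_tatePullbacksAlgebraic`; harmless for the route's intended toroidal-boundary fibres, whose
orbit stratifications are filtrable).  On the tree it also waits for the mixed Hodge structure of a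
complete singular variety — none formalised.
[cite: DeligneHodgeIII1974, Thm. 8.2.4, Prop. 8.2.5] [cite: Totaro2014ChowLinear, Thm. 1, Thm. 3, §2]
[cite: Jannsen1990MixedMotives, §14 (linear varieties)] [cite: PetersSteenbrink2008, Thm. 5.39, Cor. 5.42] -/
theorem stub_fibreCycleDetection :
    ∀ (N p : ℕ) (𝒳 C : SchemeOver ℂ) (f : 𝒳 ⟶ C) (o : AlgPoints C ℂ),
      IsSmoothProjective N 𝒳 → IsSmoothProjective 1 C → IsQbarTate (fiberOver f o) →
      ∀ u ∈ pulledBackClasses (fiberOver f o) (2 * p),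
        (∀ (Y : SchemeOver ℂ), IsSmoothProjective p Y → ∀ h : Y ⟶ fiberOver f o,
          (complexBetti.map h (2 * p)).hom u = 0) →
        u = 0 := by
  sorry

/-- STUB 2 (THE HEART; open, HC-safe) — **numerical matching on the total space: a ℚ̄-Tate fibre
cannot numerically distinguish an absolute Hodge class of the smooth projective total space from its
algebraic classes.**  For `ξ ∈ H²ᵖ(𝒳(ℂ); ℂ)` absolute Hodge there is `a ∈ algebraicClasses 𝒳 p`
(`= Nᵖ H²ᵖ(𝒳)`, the ℂ-span of cycle classes) with `(h ≫ ι)^* a = (h ≫ ι)^* ξ` in the LINE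
`H²ᵖ(Y(ℂ); ℂ)` for every smooth projective `p`-fold `h : Y → X_o` — equality of degrees on every
`p`-cycle of the fibre.  By finite-dimensional duality this says: a ℚ-combination `z = Σ cₖ (hₖ)_*[Yₖ]`
of fibre `p`-cycles, pushed into `𝒳`, that is NUMERICALLY trivial against `Aᵖ(𝒳)` pairs to zero with
`ξ`; since `z` is an algebraic `p`-cycle ON THE SMOOTH PROJECTIVE `𝒳`, this is "numerical ⟹
homological equivalence for `p`-cycles of `𝒳` supported on `X_o`" tested against Hodge classes — a
fragment of standard conjecture D(𝒳): implied by HC(𝒳) (`a := ξ`, `numericalMatching_of_hodgeConjecture`),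
by D(𝒳) + the perfect pairing `Hdgᵖ × Hdg^{N-p} → ℚ` (Hodge–Riemann), by B(𝒳) (Lieberman:
B ⟹ D), hence known when `𝒳` is an abelian variety (Lieberman 1968) or hyperkähler of
`K3^[n]`-type (Charles–Markman) and in the boundary degrees.  Sharper: because the cup pairing
`Hdgᵖ(𝒳) × Hdg^{N-p}(𝒳) → ℚ` is perfect (hard Lefschetz + Hodge–Riemann), the version of this stub
for ALL Hodge `ξ` is EQUIVALENT to `D_fib(𝒳, X_o, p)`: "a ℚ-cycle of dimension `p` on `𝒳` supported
on `X_o` and numerically trivial against `Aᵖ(𝒳)` is homologically trivial" — a statement about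
algebraic cycles only, with no transcendental input; the absolute-Hodge version typed here sits
between `D_fib` and a tautology (it asks numerically-trivial fibre cycles to be orthogonal to the
absolute Hodge classes only).
After Totaro (Thm. 1: `CH_p(X_o) ⊗ ℚ` is generated by the finitely many closures of `p`-dimensional
strata) it is a statement about a FINITE intersection matrix, decidable instance by instance
(boundary-monomial intersection numbers vs periods at a Mumford cusp).  Intended attack: (a) the
vanishing-cycle description of fibre-supported classes — `z` homologous on `𝒳` to `[X_t] ⌣ η̃` plus
component terms, reducing D for fibre-supported cycles to the polarised Hodge structure of the smooth
nearby fibre and the monodromy weight filtration (Clemens–Schmid); (b) for abelian / motivated total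
spaces, André's motivated cycles (B holds motivically; numerical = homological on abelian varieties).
Why it might fail: as a LINE, not in truth-value (it is implied by HC) — proving it may require D(𝒳)
for cycle classes genuinely entangled with the transcendental part of a RIGID total space, where no
deformation/motivated argument is available; and the absolute-Hodge hypothesis gives this lever no
grip (the statement is expected for all Hodge `ξ`), so the arithmetic economy of the route is unused.
[cite: Kleiman1968, §3 (conjecture D), Thm. 3.11–3.12]
[cite: Lieberman1968, Thm. 1 (abelian varieties), Cor. (B ⟹ D)]
[cite: Andre1996, §0.4, Thm. 0.6.2] [cite: CharlesMarkman2013, Thm. 1.1]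
[cite: Totaro2014ChowLinear, Thm. 1, Thm. 3] -/
theorem stub_numericalMatching :
    ∀ (N p : ℕ) (𝒳 C : SchemeOver ℂ) (f : 𝒳 ⟶ C) (o : AlgPoints C ℂ),
      IsSmoothProjective N 𝒳 → IsSmoothProjective 1 C → IsQbarTate (fiberOver f o) →
      ∀ ξ : complexBetti 𝒳 (2 * p), IsAbsoluteHodgeClass N 𝒳 p ξ →
        ∃ a ∈ algebraicClasses 𝒳 p,
          ∀ (Y : SchemeOver ℂ), IsSmoothProjective p Y → ∀ h : Y ⟶ fiberOver f o,
            (complexBetti.map h (2 * p)).hom ((complexBetti.map (fiberι f o) (2 * p)).hom a) =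
              (complexBetti.map h (2 * p)).hom ((complexBetti.map (fiberι f o) (2 * p)).hom ξ) := by
  sorry

/-! ### The composition: stub₁ → stub₂ → the crux, by name -/

/-- **THE LINE'S COMPOSITION** (kernel-checked, no `sorry`): fibre cycle detection (STUB 1) and
numerical matching (STUB 2) imply the crux `ArithmeticTateRestriction`: STUB 2 gives an algebraic
`a` on `𝒳` with the same `p`-fold degrees along the fibre as `ξ`; `ξ|X_o - a|X_o` is pulled back from
the smooth projective `𝒳` (`restrict_mem_pulledBackClasses`) and dies on every smooth projective
`p`-fold over the fibre, hence vanishes by STUB 1; so `ξ|X_o = a|X_o ∈ PBᵖ(X_o)`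
(`restrict_mem_pulledBackAlgebraicClasses`). [folklore] -/
theorem ArithmeticTateRestriction_of :
    (∀ (N p : ℕ) (𝒳 C : SchemeOver ℂ) (f : 𝒳 ⟶ C) (o : AlgPoints C ℂ),
      IsSmoothProjective N 𝒳 → IsSmoothProjective 1 C → IsQbarTate (fiberOver f o) →
      ∀ u ∈ pulledBackClasses (fiberOver f o) (2 * p),
        (∀ (Y : SchemeOver ℂ), IsSmoothProjective p Y → ∀ h : Y ⟶ fiberOver f o,
          (complexBetti.map h (2 * p)).hom u = 0) →
        u = 0) →
    (∀ (N p : ℕ) (𝒳 C : SchemeOver ℂ) (f : 𝒳 ⟶ C) (o : AlgPoints C ℂ),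
      IsSmoothProjective N 𝒳 → IsSmoothProjective 1 C → IsQbarTate (fiberOver f o) →
      ∀ ξ : complexBetti 𝒳 (2 * p), IsAbsoluteHodgeClass N 𝒳 p ξ →
        ∃ a ∈ algebraicClasses 𝒳 p,
          ∀ (Y : SchemeOver ℂ), IsSmoothProjective p Y → ∀ h : Y ⟶ fiberOver f o,
            (complexBetti.map h (2 * p)).hom ((complexBetti.map (fiberι f o) (2 * p)).hom a) =
              (complexBetti.map h (2 * p)).hom ((complexBetti.map (fiberι f o) (2 * p)).hom ξ)) →
    ArithmeticTateRestriction := by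
  intro h₁ h₂ N p 𝒳 C f o h𝒳 hC hT ξ hξ
  obtain ⟨a, ha, hnum⟩ := h₂ N p 𝒳 C f o h𝒳 hC hT ξ hξ
  have hmem : (complexBetti.map (fiberι f o) (2 * p)).hom ξ -
      (complexBetti.map (fiberι f o) (2 * p)).hom a ∈ pulledBackClasses (fiberOver f o) (2 * p) :=
    Submodule.sub_mem _ (restrict_mem_pulledBackClasses h𝒳 f o ξ)
      (restrict_mem_pulledBackClasses h𝒳 f o a)
  have hzero : (complexBetti.map (fiberι f o) (2 * p)).hom ξ -
      (complexBetti.map (fiberι f o) (2 * p)).hom a = 0 :=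
    h₁ N p 𝒳 C f o h𝒳 hC hT _ hmem (fun Y hY h ↦ by rw [map_sub, hnum Y hY h, sub_self])
  rw [sub_eq_zero] at hzero
  rw [hzero]
  exact restrict_mem_pulledBackAlgebraicClasses h𝒳 f o ha

/-- **The crux, closed modulo exactly the two registered stubs.** -/
theorem ArithmeticTateRestriction_of_stubs : ArithmeticTateRestriction :=
  ArithmeticTateRestriction_of stub_fibreCycleDetection stub_numericalMatching

/-! ### Proved sanity: the heart for algebraic classes, HC-safety, and three unconditional rungs -/

/-- The heart's one-line mechanism: if `ξ` is itself algebraic on `𝒳`, take `a := ξ`. [folklore] -/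
theorem numericalMatching_of_mem_algebraicClasses {p : ℕ} {𝒳 C : SchemeOver ℂ}
    (f : 𝒳 ⟶ C) (o : AlgPoints C ℂ) {ξ : complexBetti 𝒳 (2 * p)} (hξ : ξ ∈ algebraicClasses 𝒳 p) :
    ∃ a ∈ algebraicClasses 𝒳 p,
      ∀ (Y : SchemeOver ℂ), IsSmoothProjective p Y → ∀ h : Y ⟶ fiberOver f o,
        (complexBetti.map h (2 * p)).hom ((complexBetti.map (fiberι f o) (2 * p)).hom a) =
          (complexBetti.map h (2 * p)).hom ((complexBetti.map (fiberι f o) (2 * p)).hom ξ) :=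
  ⟨ξ, hξ, fun _ _ _ ↦ rfl⟩

/-- **HC-safety of the heart (PROVED)**: the Hodge conjecture implies STUB 2 — an absolute Hodge
class is a rational `(p,p)` class, algebraic on `𝒳` under HC, and `a := ξ` matches itself.  So STUB 2
(like the crux) cannot be refuted short of a counterexample to HC; the risk of the line is hardness,
concentrated in STUB 2. [cite: Deligne2000, §1] -/
theorem numericalMatching_of_hodgeConjecture (hHC : _root_.HodgeConjecture) :
    ∀ (N p : ℕ) (𝒳 C : SchemeOver ℂ) (f : 𝒳 ⟶ C) (o : AlgPoints C ℂ),
      IsSmoothProjective N 𝒳 → IsSmoothProjective 1 C → IsQbarTate (fiberOver f o) →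
      ∀ ξ : complexBetti 𝒳 (2 * p), IsAbsoluteHodgeClass N 𝒳 p ξ →
        ∃ a ∈ algebraicClasses 𝒳 p,
          ∀ (Y : SchemeOver ℂ), IsSmoothProjective p Y → ∀ h : Y ⟶ fiberOver f o,
            (complexBetti.map h (2 * p)).hom ((complexBetti.map (fiberι f o) (2 * p)).hom a) =
              (complexBetti.map h (2 * p)).hom ((complexBetti.map (fiberι f o) (2 * p)).hom ξ) :=
  fun _N p _𝒳 _C f o h𝒳 _ _ ξ hξ ↦
    numericalMatching_of_mem_algebraicClasses f o ((hHC h𝒳).2 p ξ hξ.isRationalClass hξ.isOfHodgeType)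

/-- … hence HC implies the crux through THIS line's seam as well (stub 1 is not even needed for
that: `example` only, so that the theorems concluding the crux by name are the skeleton's). -/
example (hHC : _root_.HodgeConjecture) : ArithmeticTateRestriction :=
  fun _N p _𝒳 _C f o h𝒳 _ _ ξ hξ ↦
    restrict_mem_pulledBackAlgebraicClasses h𝒳 f o ((hHC h𝒳).2 p ξ hξ.isRationalClass hξ.isOfHodgeType)

/-- **Rung `p = 1` of the heart (PROVED, unconditional, any fibre)**: an absolute Hodge class in `H²`
is a rational `(1,1)` class, algebraic by Lefschetz `(1,1)` (tree theorem
`lefschetzOneOne_rational_holds`). [cite: VoisinHodgeI2002, Thm. 11.30] -/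
theorem numericalMatching_codimOne :
    ∀ (N : ℕ) (𝒳 C : SchemeOver ℂ) (f : 𝒳 ⟶ C) (o : AlgPoints C ℂ),
      IsSmoothProjective N 𝒳 → IsSmoothProjective 1 C → IsQbarTate (fiberOver f o) →
      ∀ ξ : complexBetti 𝒳 (2 * 1), IsAbsoluteHodgeClass N 𝒳 1 ξ →
        ∃ a ∈ algebraicClasses 𝒳 1,
          ∀ (Y : SchemeOver ℂ), IsSmoothProjective 1 Y → ∀ h : Y ⟶ fiberOver f o,
            (complexBetti.map h (2 * 1)).hom ((complexBetti.map (fiberι f o) (2 * 1)).hom a) =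
              (complexBetti.map h (2 * 1)).hom ((complexBetti.map (fiberι f o) (2 * 1)).hom ξ) :=
  fun _N _𝒳 _C f o h𝒳 _ _ ξ hξ ↦
    numericalMatching_of_mem_algebraicClasses f o
      (lefschetzOneOne_rational_holds h𝒳 ξ hξ.isRationalClass hξ.isOfHodgeType)

/-- **Rung `dim 𝒳 ≤ 3` of the heart (PROVED, unconditional)**: HC holds on total spaces of
dimension `≤ 3` (tree theorem `hodgeClasses_algebraic_of_dim_le_three_holds`).
[cite: VoisinHodgeII2003, §10.2.3 proof of Prop. 10.26] -/
theorem numericalMatching_dimLEThree :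
    ∀ (N p : ℕ) (𝒳 C : SchemeOver ℂ) (f : 𝒳 ⟶ C) (o : AlgPoints C ℂ), N ≤ 3 →
      IsSmoothProjective N 𝒳 → IsSmoothProjective 1 C → IsQbarTate (fiberOver f o) →
      ∀ ξ : complexBetti 𝒳 (2 * p), IsAbsoluteHodgeClass N 𝒳 p ξ →
        ∃ a ∈ algebraicClasses 𝒳 p,
          ∀ (Y : SchemeOver ℂ), IsSmoothProjective p Y → ∀ h : Y ⟶ fiberOver f o,
            (complexBetti.map h (2 * p)).hom ((complexBetti.map (fiberι f o) (2 * p)).hom a) =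
              (complexBetti.map h (2 * p)).hom ((complexBetti.map (fiberι f o) (2 * p)).hom ξ) :=
  fun _N p _𝒳 _C f o hN h𝒳 _ _ ξ hξ ↦
    numericalMatching_of_mem_algebraicClasses f o
      (hodgeClasses_algebraic_of_dim_le_three_holds hN h𝒳 p ξ hξ.isRationalClass hξ.isOfHodgeType)

/-- **Rung `p = N ≥ 1` of the heart (PROVED, unconditional)**: top-degree classes of the total space
are algebraic (tree theorem `mem_algebraicClasses_of_degree_top`: `H²ᴺ(𝒳(ℂ); ℂ) = ℂ · cl(pt)`).
[cite: VoisinHodgeI2002, Thm. 11.32] -/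
theorem numericalMatching_degreeTop :
    ∀ (N : ℕ) (𝒳 C : SchemeOver ℂ) (f : 𝒳 ⟶ C) (o : AlgPoints C ℂ), 1 ≤ N →
      IsSmoothProjective N 𝒳 → IsSmoothProjective 1 C → IsQbarTate (fiberOver f o) →
      ∀ ξ : complexBetti 𝒳 (2 * N), IsAbsoluteHodgeClass N 𝒳 N ξ →
        ∃ a ∈ algebraicClasses 𝒳 N,
          ∀ (Y : SchemeOver ℂ), IsSmoothProjective N Y → ∀ h : Y ⟶ fiberOver f o,
            (complexBetti.map h (2 * N)).hom ((complexBetti.map (fiberι f o) (2 * N)).hom a) =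
              (complexBetti.map h (2 * N)).hom ((complexBetti.map (fiberι f o) (2 * N)).hom ξ) :=
  fun _N _𝒳 _C f o hN h𝒳 _ _ ξ _ ↦
    numericalMatching_of_mem_algebraicClasses f o (mem_algebraicClasses_of_degree_top h𝒳 hN ξ)

/-- **Degrees live on a line (PROVED pointer)**: for a smooth projective `p`-fold `Y` the target of
every test pull-back in the two stubs, `H²ᵖ(Y(ℂ); ℂ)`, is one-dimensional — "equality of `p`-fold
pull-backs" in STUB 2 is equality of finitely many NUMBERS per test, and "vanishing" in STUB 1 is the
vanishing of a degree. [cite: HatcherAT2002, §3.3 Cor. 3.37] -/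
theorem finrank_testTarget_eq_one {p : ℕ} {Y : SchemeOver ℂ} (hY : IsSmoothProjective p Y) :
    Module.finrank ℂ (complexBetti Y (2 * p)) = 1 :=
  finrank_complexBetti_two_mul_eq_one hY

end Summit.HodgeConjecture.HodgeConjecture.Cruxes.ArithmeticTateRestriction.FibreNumerical

end
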